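import Summits.KontsevichZagierPeriods.KontsevichZagierPeriods.Theorems.SoloInformedSmoothUnit
import Summits.KontsevichZagierPeriods.KontsevichZagierPeriods.Theorems.SoloInformedNonintPoint
import HarnessLib

/-!
# Transport rules for the leaves: grid cells, the coordinate swap, and the sign of `C`

Solo programme `solo-KontsevichZagierPeriods-informed`, session s110, PRES-RAT(2) step (β)-6a.

Three tools used by every leaf of the PRES-RAT(2) recursion:

* `soloInformed_presOn_inter_gridCell_of_pullback` — rule (2) along the grid map
  `Φ(x) = (j + x)/N`: `f` is presentable on `Ω ∩ Φ([0,1]ⁿ)` as soon as `f ∘ Φ · N⁻ⁿ` is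
  presentable on `Φ⁻¹(Ω) ∩ [0,1]ⁿ` (the preimage is again `ℚ`-semialgebraic,
  `soloInformed_isSemialgebraic_preimage_gridMap`);
* `soloInformed_presOn_of_swap` — rule (2) along the coordinate swap (determinant `−1`);
* `soloInformed_sign_of_pderiv_pos` — on a vertical segment where `∂C/∂y > 0` the sign of
  `C(x, y)` is the sign of `y − a` for the unique zero `a`.

References: M. Kontsevich, D. Zagier, *Periods* (2001) §1.2.
-/

noncomputable section

open scoped BigOperators Topology
open MeasureTheory Set Metric
open Literature.NumberTheory.Transcendental Literature.NumberTheory.Transcendental.KZ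
open Literature.ModelTheory.ExponentialFields (IsSemialgebraic)

namespace Summit.KontsevichZagierPeriods.KontsevichZagierPeriods.Theorems

variable {n : ℕ} {K : Type*} [Field K] [Algebra K ℝ]

/-! ### Transport along the grid map -/

/-- The grid map is continuous. -/
theorem soloInformed_continuous_gridMap (N : ℕ) (j : Fin n → Fin N) :
    Continuous (soloInformedGridMap N j) :=
  continuous_pi fun l => (continuous_const.add (continuous_apply l)).div_const _

/-- The grid map as a `ℚ`-polynomial map. -/
theorem soloInformed_gridMap_eq_aeval (N : ℕ) (j : Fin n → Fin N) :
    (fun (x : Fin n → ℝ) (l : Fin n) => (MvPolynomial.aeval x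
      (MvPolynomial.C (((j l : ℕ) : ℚ) / N) + MvPolynomial.C ((1 : ℚ) / N) * MvPolynomial.X l :
        MvPolynomial (Fin n) ℚ) : ℝ)) = soloInformedGridMap N j := by
  funext x
  ext l
  simp only [soloInformedGridMap_apply, map_add, map_mul, MvPolynomial.aeval_C,
    MvPolynomial.aeval_X, eq_ratCast]
  push_cast
  ring

/-- Preimages of `ℚ`-semialgebraic sets under the grid map are `ℚ`-semialgebraic. -/
theorem soloInformed_isSemialgebraic_preimage_gridMap {Ω : Set (Fin n → ℝ)}
    (hΩ : IsSemialgebraic ℚ Ω) (N : ℕ) (j : Fin n → Fin N) :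
    IsSemialgebraic ℚ (soloInformedGridMap N j ⁻¹' Ω) := by
  rw [← soloInformed_gridMap_eq_aeval N j]
  exact hΩ.preimage_aeval _

/-- **Transport along the grid map.**  `f` is presentable on `Ω ∩ Z` for the grid cell `Z = Φ([0,1]ⁿ)`
as soon as the pulled-back function `f(Φ x) · N⁻ⁿ` is presentable on `Φ⁻¹(Ω) ∩ [0,1]ⁿ`. -/
theorem soloInformed_presOn_inter_gridCell_of_pullback {Ω : Set (Fin n → ℝ)}
    (hΩ : IsSemialgebraic ℚ Ω) {N : ℕ} (hN : 0 < N) (j : Fin n → Fin N) {f : (Fin n → ℝ) → ℝ}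
    (h : SoloInformedPresOn (soloInformedGridMap N j ⁻¹' Ω ∩ soloInformedCube n)
      (fun x => f (soloInformedGridMap N j x) * ((N : ℝ)⁻¹) ^ n)) :
    SoloInformedPresOn (Ω ∩ soloInformedGridCell N j) f := by
  have hNr : (0 : ℝ) < N := by exact_mod_cast hN
  set S : Set (Fin n → ℝ) := soloInformedGridMap N j ⁻¹' Ω ∩ soloInformedCube n with hS_def
  have hS : IsSemialgebraic ℚ S :=
    (soloInformed_isSemialgebraic_preimage_gridMap hΩ N j).inter (isSemialgebraic_soloInformedCube n)
  have himg : soloInformedGridMap N j '' S = Ω ∩ soloInformedGridCell N j := by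
    rw [hS_def, image_preimage_inter, soloInformed_image_gridMap_cube hN j]
  rw [← himg]
  refine soloInformed_presOn_image hS (soloInformedGridMap N j)
    (fun _ => (N : ℝ)⁻¹ • ContinuousLinearMap.id ℝ (Fin n → ℝ))
    ((soloInformed_isSemialgebraicMapOn_gridMap N j).mono inter_subset_right hS)
    (fun x _ => soloInformed_hasFDerivWithinAt_gridMap N j _ x)
    ((soloInformed_gridMap_injective hN j).injOn) ?_ ?_
  · refine (isSemialgebraicFunOn_const_ratCast hS (((N : ℚ)⁻¹) ^ n)).congr fun x _ => ?_
    rw [soloInformed_det_gridMap_deriv, abs_of_nonneg (by positivity)]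
    push_cast
    rfl
  · refine (soloInformed_presOn_congr fun x _ => ?_).1 h
    simp only [soloInformed_det_gridMap_deriv, abs_of_nonneg (pow_nonneg (inv_nonneg.2 hNr.le) n)]

/-! ### Transport along the coordinate swap -/

/-- The coordinate swap as a continuous linear map. [this work] -/
def soloInformedSwapCLM : (Fin 2 → ℝ) →L[ℝ] (Fin 2 → ℝ) :=
  LinearMap.toContinuousLinearMap (Matrix.toLin' (!![0, 1; 1, 0] : Matrix (Fin 2) (Fin 2) ℝ))

/-- Values of the swap map. -/
theorem soloInformedSwapCLM_apply (z : Fin 2 → ℝ) : soloInformedSwapCLM z = ![z 1, z 0] := by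
  unfold soloInformedSwapCLM
  rw [LinearMap.coe_toContinuousLinearMap', Matrix.toLin'_apply]
  ext i
  fin_cases i <;> simp [Matrix.mulVec, dotProduct, Fin.sum_univ_two]

/-- The swap has determinant `−1`. -/
theorem soloInformed_det_swapCLM : soloInformedSwapCLM.det = -1 := by
  unfold soloInformedSwapCLM
  rw [ContinuousLinearMap.det, LinearMap.coe_toContinuousLinearMap, LinearMap.det_toLin',
    Matrix.det_fin_two_of]
  ring

/-- **Transport along the swap.**  `f` is presentable on `Ω` as soon as `f ∘ swap` is presentable
on `swap⁻¹(Ω)`. -/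
theorem soloInformed_presOn_of_swap {Ω : Set (Fin 2 → ℝ)} (hΩ : IsSemialgebraic ℚ Ω)
    {f : (Fin 2 → ℝ) → ℝ}
    (h : SoloInformedPresOn ((fun z : Fin 2 → ℝ => (![z 1, z 0] : Fin 2 → ℝ)) ⁻¹' Ω)
      (fun z => f ![z 1, z 0])) :
    SoloInformedPresOn Ω f := by
  set sw : (Fin 2 → ℝ) → (Fin 2 → ℝ) := fun z => ![z 1, z 0] with hsw
  have hsw2 : ∀ z, sw (sw z) = z := fun z => by
    funext i
    fin_cases i <;> rfl
  have hsurj : Function.Surjective sw := fun z => ⟨sw z, hsw2 z⟩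
  have hcomp : (fun x : Fin 2 → ℝ => x ∘ (Equiv.swap (0 : Fin 2) 1)) = sw := by
    funext x
    funext i
    fin_cases i
    · simp [hsw, Equiv.swap_apply_left]
    · simp [hsw, Equiv.swap_apply_right]
  have hS : IsSemialgebraic ℚ (sw ⁻¹' Ω) := by
    have h := hΩ.preimage_comp (R := ℝ) (Equiv.swap (0 : Fin 2) 1)
    rwa [hcomp] at h
  rw [← image_preimage_eq Ω hsurj]
  refine soloInformed_presOn_image hS sw (fun _ => soloInformedSwapCLM) ?_ ?_
    (fun x _ y _ hxy => by rw [← hsw2 x, ← hsw2 y]; exact congrArg sw hxy) ?_ ?_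
  · refine (isSemialgebraicMapOn_aeval (R := ℝ) hS
      fun l : Fin 2 => (MvPolynomial.X ((Equiv.swap (0 : Fin 2) 1) l) :
        MvPolynomial (Fin 2) ℚ)).congr fun x _ => ?_
    funext l
    fin_cases l
    · simp [hsw, Equiv.swap_apply_left]
    · simp [hsw, Equiv.swap_apply_right]
  · intro x _
    have hfun : (⇑soloInformedSwapCLM : (Fin 2 → ℝ) → (Fin 2 → ℝ)) = sw :=
      funext fun z => soloInformedSwapCLM_apply z
    rw [← hfun]
    exact soloInformedSwapCLM.hasFDerivAt.hasFDerivWithinAt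
  · refine (isSemialgebraicFunOn_const_ratCast hS 1).congr fun x _ => ?_
    rw [soloInformed_det_swapCLM]
    simp
  · refine (soloInformed_presOn_congr fun x _ => ?_).1 h
    simp only [soloInformed_det_swapCLM, abs_neg, abs_one, mul_one, hsw]

/-- The swapped grid cell. -/
theorem soloInformed_swap_preimage_gridCell (N : ℕ) (j : Fin 2 → Fin N) :
    (fun z : Fin 2 → ℝ => (![z 1, z 0] : Fin 2 → ℝ)) ⁻¹' soloInformedGridCell N j =
      soloInformedGridCell N (j ∘ (Equiv.swap (0 : Fin 2) 1)) := by
  ext z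
  simp only [mem_preimage, soloInformed_mem_gridCell_iff, Function.comp_apply]
  constructor
  · intro h l
    fin_cases l
    · simpa [Equiv.swap_apply_left] using h 1
    · simpa [Equiv.swap_apply_right] using h 0
  · intro h l
    fin_cases l
    · simpa [Equiv.swap_apply_right] using h 1
    · simpa [Equiv.swap_apply_left] using h 0

/-! ### The sign of `C` near a point with `∂C/∂y > 0` -/

/-- **Sign lemma.**  If `∂C/∂y > 0` on the box `|x − p₀| < R₀, |y − p₁| < R`, `C(x, a) = 0` with
`|a − p₁| < R`, then on the vertical segment `|y − p₁| < R` over `x` the sign of `C(x, y)` is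
the sign of `y − a`. -/
theorem soloInformed_sign_of_pderiv_pos (C : MvPolynomial (Fin 2) K) {x a p₁ R : ℝ}
    (hpos : ∀ y : ℝ, |y - p₁| < R → 0 < (MvPolynomial.aeval ![x, y] (MvPolynomial.pderiv 1 C) : ℝ))
    (ha : |a - p₁| < R) (hCa : (MvPolynomial.aeval ![x, a] C : ℝ) = 0) {y : ℝ} (hy : |y - p₁| < R) :
    ((0 < (MvPolynomial.aeval ![x, y] C : ℝ)) ↔ a < y) ∧
      (((MvPolynomial.aeval ![x, y] C : ℝ) < 0) ↔ y < a) := by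
  have hI : ∀ t : ℝ, |t - p₁| < R ↔ t ∈ Ioo (p₁ - R) (p₁ + R) := fun t => by
    rw [abs_lt, mem_Ioo]; constructor <;> intro h <;> constructor <;> linarith [h.1, h.2]
  have hmono : StrictMonoOn (fun t : ℝ => (MvPolynomial.aeval ![x, t] C : ℝ))
      (Ioo (p₁ - R) (p₁ + R)) := by
    refine strictMonoOn_of_deriv_pos (convex_Ioo _ _)
      (HasDerivAt.continuousOn fun t _ => soloInformed_hasDerivAt_aevalK_snd C x t) fun t ht => ?_
    rw [interior_Ioo] at ht
    rw [(soloInformed_hasDerivAt_aevalK_snd C x t).deriv]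
    exact hpos t ((hI t).2 ht)
  have haI := (hI a).1 ha
  have hyI := (hI y).1 hy
  constructor
  · rw [← hCa]
    exact hmono.lt_iff_lt haI hyI
  · rw [← hCa]
    exact hmono.lt_iff_lt hyI haI

end Summit.KontsevichZagierPeriods.KontsevichZagierPeriods.Theorems
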